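import Summits.NavierStokesRegularity.NavierStokesRegularity.Theses.PumpContinuation
import Summits.NavierStokesRegularity.NavierStokesRegularity.Theorems.BoundedTemperatureClosed.Negative.IsSymmetricDecoration
import Summits.NavierStokesRegularity.NavierStokesRegularity.Theorems.PumpContinuationEulerProximatePumpScalingTools
import Summits.NavierStokesRegularity.NavierStokesRegularity.Theorems.PerpetualPumpThesisFloor
import Literature.Analysis.FluidPDE.TaoAveragedComplexAverageReal
import Literature.Analysis.FluidPDE.TaoCascadeProjection
import Literature.Analysis.FluidPDE.TaoAveragedCascade

/-!
# Crux `BoundedTemperatureClosed` (stmt-NavierStokesRegularity-18303), negative side: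
# the zero averaging datum — tools

Negative-side support lemmas of the line lead (line `Sketch`, stub `stub_attain`): the instance of the
crux at the **zero averaging datum** (symbols `mᵢ ≡ 0`, rotations `id`, dilations `1`; its form
`⟨B̃(u,v), w⟩` vanishes identically, so it is symmetric and cancelling for free). Along the route's
segment `T_θ = (1-θ)·B̃ + θ·B` this datum gives `T_θ = θ·B`, a positive multiple of the true
Navier–Stokes (Euler) form, and Tao's mild formulation is covariant under the amplitude rescaling
`u ↦ θ u` (landed `PumpContinuationEulerProximatePump.typeIBlowup_smul`). Consequences proved here:

* `exists_form_eq_zero` — a symmetric cancelling averaging datum with identically vanishing form exists.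
* `mem_btSet_iff_of_form_eq_zero` — for such a datum and `0 < θ ≤ 1`: `θ` lies in the
  bounded-temperature blow-up set at ceiling `M` iff Navier–Stokes itself has a Schwartz-data
  `H¹⁰_df`-mild Type-I blow-up (no mild extension) at ceiling `θ M`.
* `zero_not_mem_btSet_of_form_eq_zero` — `θ = 0` is never a member: there the equation is the heat
  equation, `u(t) = e^{tΔ}u(0)` is `H¹⁰`-bounded, and the landed `H¹⁰` continuation criterion
  (`PerpetualPumpThesis.stub_thesis_H10Continuation`, valid for every averaging datum) extends it.
* `pos_of_nsTypeI`, `nsTypeI_mono` — the set of admissible Navier–Stokes Type-I ceilings is an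
  up-set of positive reals (a ceiling `M ≤ 0` forces `u ≡ 0`, which extends by zero).
* `nsTypeI_of_forall_lt`, `not_forall_pos_nsTypeI` (+ `…_of_boundedTemperatureClosed`) — closedness
  of the sets of a form-zero datum forces ATTAINMENT (every positive ceiling all of whose strict upper
  ceilings are admissible is admissible) and a TEMPERATURE FLOOR (not every positive ceiling is
  admissible); so the crux proves two open Navier–Stokes statements.

The companion file `ZeroDatumDichotomy.lean` turns these into: the crux (as quantified, `∀ 𝒜 ∀ M`)
implies — and at the zero datum is equivalent to — the Navier–Stokes dichotomy "no Schwartz-data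
`H¹⁰_df`-mild Type-I blow-up at all, or a coldest one (the set of admissible Type-I ceilings is a closed
ray `[m*, ∞)`, `m* > 0`)", an open statement foreign to the route's `closes`.

## References

* T. Tao, J. Amer. Math. Soc. 29 (2016), arXiv:1402.0290v3, §1.1 (1.13), (1.15). [`Tao2016AveragedNS`]
-/

noncomputable section

-- the nested summit namespace `…NavierStokesRegularity.NavierStokesRegularity…` is the tree's layout
-- (D-0017), so the duplicated-namespace linter must be silenced for every declaration below
set_option linter.dupNamespace false

namespace Summit.NavierStokesRegularity.NavierStokesRegularity.Theorems.BoundedTemperatureClosed.Negative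

open MeasureTheory Set Filter Topology
open scoped ENNReal FourierTransform
open Literature.Analysis.FluidPDE Literature.Analysis.FluidPDE.Tao2016
open Literature.Analysis.FunctionSpaces (eFourierSobolevNorm)
open Summit.NavierStokesRegularity.NavierStokesRegularity.Theses.PumpContinuation
open Summit.NavierStokesRegularity.NavierStokesRegularity.Theorems.PumpContinuationEulerProximatePump
  (typeIBlowup_smul)
open Summit.NavierStokesRegularity.NavierStokesRegularity.Theorems.PerpetualPumpThesis
  (stub_thesis_H10Continuation)
open Summit.NavierStokesRegularity.NavierStokesRegularity.Theorems.PerpetualPumpThesis.G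
  (heat_heat eq_of_forall_pairing_eq)

/-- The bounded-temperature blow-up set of the datum `𝒜` at ceiling `M` along the segment
`T_θ = (1-θ)·B̃_𝒜 + θ·B` — verbatim the set whose closedness the crux asserts. -/
local notation3 "btSet[" 𝒜 ", " M "]" =>
  {θ : ℝ | θ ∈ Set.Icc (0 : ℝ) 1 ∧
    ∃ u₀ : SchwartzMap (EuclideanSpace ℝ (Fin 3)) (EuclideanSpace ℝ (Fin 3)),
      Literature.Analysis.FluidPDE.VectorCalculus.IsDivFree ⇑u₀ ∧ ∃ S : ℝ, 0 < S ∧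
      ∃ u : ℝ → Literature.Analysis.FluidPDE.Tao2016.L2C,
        Literature.Analysis.FluidPDE.Tao2016.IsMildSolutionFor
          (fun a b c => ((1 - θ : ℝ) : ℂ) * AveragingDatum.form 𝒜 a b c +
            ((θ : ℝ) : ℂ) * Literature.Analysis.FluidPDE.Tao2016.eulerForm a b c)
          (Literature.Analysis.FluidPDE.Tao2016.schwartzL2 u₀) (Set.Ico 0 S) u ∧
        (∀ t ∈ Set.Ico 0 S, MeasureTheory.eLpNorm (u t) ⊤ MeasureTheory.volume ≤
          ENNReal.ofReal (M / Real.sqrt (S - t))) ∧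
        ¬ ∃ S' : ℝ, S < S' ∧ ∃ v : ℝ → Literature.Analysis.FluidPDE.Tao2016.L2C,
          Literature.Analysis.FluidPDE.Tao2016.IsMildSolutionFor
            (fun a b c => ((1 - θ : ℝ) : ℂ) * AveragingDatum.form 𝒜 a b c +
              ((θ : ℝ) : ℂ) * Literature.Analysis.FluidPDE.Tao2016.eulerForm a b c)
            (Literature.Analysis.FluidPDE.Tao2016.schwartzL2 u₀) (Set.Ico 0 S') v ∧
          ∀ t ∈ Set.Ico 0 S, v t = u t}

/-- **Navier–Stokes has a Schwartz-data `H¹⁰_df`-mild Type-I blow-up at ceiling `M`**: a Schwartz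
divergence-free datum, a time `S > 0` and an `H¹⁰_df`-mild solution of the true Navier–Stokes form
(Tao (1.5), `ν = 1`) on `[0,S)` with `‖u t‖_∞ ≤ M/√(S-t)` and no mild extension past `S` — the
membership predicate of the crux's set at the Euler end `θ = 1`. -/
local notation3 "nsTypeI[" M "]" =>
  ∃ u₀ : SchwartzMap (EuclideanSpace ℝ (Fin 3)) (EuclideanSpace ℝ (Fin 3)),
    Literature.Analysis.FluidPDE.VectorCalculus.IsDivFree ⇑u₀ ∧ ∃ S : ℝ, 0 < S ∧
    ∃ u : ℝ → Literature.Analysis.FluidPDE.Tao2016.L2C,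
      Literature.Analysis.FluidPDE.Tao2016.IsMildSolutionFor
        Literature.Analysis.FluidPDE.Tao2016.eulerForm
        (Literature.Analysis.FluidPDE.Tao2016.schwartzL2 u₀) (Set.Ico 0 S) u ∧
      (∀ t ∈ Set.Ico 0 S, MeasureTheory.eLpNorm (u t) ⊤ MeasureTheory.volume ≤
        ENNReal.ofReal (M / Real.sqrt (S - t))) ∧
      ¬ ∃ S' : ℝ, S < S' ∧ ∃ v : ℝ → Literature.Analysis.FluidPDE.Tao2016.L2C,
        Literature.Analysis.FluidPDE.Tao2016.IsMildSolutionFor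
          Literature.Analysis.FluidPDE.Tao2016.eulerForm
          (Literature.Analysis.FluidPDE.Tao2016.schwartzL2 u₀) (Set.Ico 0 S') v ∧
        ∀ t ∈ Set.Ico 0 S, v t = u t

/-! ### The zero averaging datum -/

/-- **The zero averaging datum exists**: the deterministic datum with symbols `mᵢ ≡ 0` (a real order-`0`
symbol, `isRealSymbol_const 0`), rotations `id` and dilation factors `1` is an averaging datum in Tao's
sense whose form `⟨B̃(u,v), w⟩ = 𝔼 ⟨B(0,0), 0⟩` vanishes identically; in particular it is symmetric
and has the cancellation property (1.16). [cite: Tao2016AveragedNS, §1.1 (1.13)] -/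
theorem exists_form_eq_zero :
    ∃ 𝒜 : AveragingDatum, 𝒜.IsSymmetric ∧ 𝒜.HasCancellation ∧ ∀ u v w : L2C, 𝒜.form u v w = 0 := by
  let 𝒜 : AveragingDatum :=
    { Ω := Unit
      μ := Measure.dirac ()
      m := fun _ _ _ => ((0 : ℝ) : ℂ)
      R := fun _ _ => LinearIsometryEquiv.refl ℝ _
      lam := fun _ _ => 1
      isRealSymbol := fun _ _ => isRealSymbol_const 0
      det_R := fun _ _ => LinearMap.det_id
      lam_pos := fun _ _ => one_pos
      lam_bdd := ⟨1, fun _ _ => by norm_num⟩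
      moment := fun k₁ k₂ k₃ => by
        rw [lintegral_dirac]
        have hfin : ∀ k, symbolSeminorm k (fun _ : EuclideanSpace ℝ (Fin 3) => ((0 : ℝ) : ℂ)) < ∞ :=
          fun k => (isRealSymbol_const 0).2.1 k
        exact ENNReal.mul_lt_top (ENNReal.mul_lt_top (hfin k₁) (hfin k₂)) (hfin k₃)
      measurable_m := fun _ _ _ => measurable_const
      measurable_R := fun _ _ => measurable_const
      measurable_lam := fun _ => measurable_const }
  -- its symbols are the zero `L^∞` class, so every slot operator is `0`
  have hsymb : ∀ i θ, 𝒜.symbolLp i θ = 0 := by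
    intro i θ
    rw [Lp.eq_zero_iff_ae_eq_zero]
    unfold AveragingDatum.symbolLp
    filter_upwards [MemLp.coeFn_toLp ((𝒜.isRealSymbol i θ).memLp_top)] with ξ hξ
    rw [hξ]
    exact Complex.ofReal_zero
  have hslot : ∀ i θ (u : L2C), 𝒜.slot i θ u = 0 := by
    intro i θ u
    unfold AveragingDatum.slot fourierMultiplier
    rw [hsymb, MeasureTheory.Lp.zero_smul, FourierTransform.fourierInv_zero]
  have hform : ∀ u v w : L2C, 𝒜.form u v w = 0 := by
    intro u v w
    unfold AveragingDatum.form
    simp only [hslot, eulerForm_zero_left, integral_zero]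
  exact ⟨𝒜, fun u v w _ _ _ => by rw [hform, hform], fun u _ => hform u u u, hform⟩

/-! ### The segment of a form-zero datum is `θ·B`; amplitude rescaling -/

/-- `⟨B(k a, k b), w⟩ = k² ⟨B(a,b), w⟩` (bilinearity of the Euler form, from the landed
`eulerForm_smul₁` and the symmetry `eulerForm_symm`). [cite: Tao2016AveragedNS, (1.3)] -/
theorem eulerForm_smul_smul (k : ℂ) (a b w : L2C) :
    eulerForm (k • a) (k • b) w = k ^ 2 * eulerForm a b w := by
  rw [eulerForm_smul₁, eulerForm_symm, eulerForm_smul₁, eulerForm_symm]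
  ring

/-- **Membership at `θ > 0` for a form-zero datum is a Navier–Stokes statement.** If the form of `𝒜`
vanishes identically, then for `0 < θ ≤ 1` the parameter `θ` lies in the bounded-temperature blow-up
set at ceiling `M` iff Navier–Stokes has a Schwartz-data `H¹⁰_df`-mild Type-I blow-up (no mild
extension) at ceiling `θ M`: the segment form is `θ·B`, and `u ↦ θ u` carries `θ·B`-witnesses at
ceiling `M` to `B`-witnesses at ceiling `θ M` and back (`typeIBlowup_smul` with `c = θ`, `c = θ⁻¹`).
[cite: Tao2016AveragedNS, §1.1 (1.15)] -/
theorem mem_btSet_iff_of_form_eq_zero {𝒜 : AveragingDatum} (h0 : ∀ u v w : L2C, 𝒜.form u v w = 0)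
    {θ : ℝ} (hθ : 0 < θ) (hθ1 : θ ≤ 1) (M : ℝ) :
    θ ∈ btSet[𝒜, M] ↔ nsTypeI[θ * M] := by
  have hdiag : ∀ a c : L2C, ((1 - θ : ℝ) : ℂ) * 𝒜.form a a c + ((θ : ℝ) : ℂ) * eulerForm a a c =
      ((θ : ℝ) : ℂ) * eulerForm a a c := fun a c => by
    rw [h0, mul_zero, zero_add]
  have hθc : ((θ : ℝ) : ℂ) ≠ 0 := Complex.ofReal_ne_zero.2 hθ.ne'
  have hT1 : ∀ a b w : L2C, eulerForm (((θ : ℝ) : ℂ) • a) (((θ : ℝ) : ℂ) • b) w =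
      ((θ : ℝ) : ℂ) * (((θ : ℝ) : ℂ) * eulerForm a b w) := fun a b w => by
    rw [eulerForm_smul_smul]
    ring
  have hT2 : ∀ a b w : L2C, ((θ : ℝ) : ℂ) * eulerForm (((θ⁻¹ : ℝ) : ℂ) • a) (((θ⁻¹ : ℝ) : ℂ) • b) w =
      ((θ⁻¹ : ℝ) : ℂ) * eulerForm a b w := fun a b w => by
    rw [eulerForm_smul_smul, Complex.ofReal_inv]
    field_simp
  simp only [mem_setOf_eq,
    isMildSolutionFor_congr_diag
      (T := fun a b c => ((1 - θ : ℝ) : ℂ) * 𝒜.form a b c + ((θ : ℝ) : ℂ) * eulerForm a b c)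
      (T' := fun a b c => ((θ : ℝ) : ℂ) * eulerForm a b c) hdiag]
  constructor
  · rintro ⟨-, hw⟩
    exact typeIBlowup_smul (fun a b c => ((θ : ℝ) : ℂ) * eulerForm a b c) eulerForm θ hθ hT1 M hw
  · intro hw
    have h := typeIBlowup_smul eulerForm (fun a b c => ((θ : ℝ) : ℂ) * eulerForm a b c) θ⁻¹
      (inv_pos.2 hθ) hT2 (θ * M) hw
    rw [← mul_assoc, inv_mul_cancel₀ hθ.ne', one_mul] at h
    exact ⟨⟨hθ.le, hθ1⟩, h⟩

/-! ### `θ = 0` is never a member: the heat equation does not blow up -/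

/-- **At `θ = 0` the bounded-temperature blow-up set of a form-zero datum is empty.** There the segment
form is the (vanishing) form of `𝒜`, a mild solution satisfies `⟨u t, w⟩ = ⟨e^{tΔ}u₀, w⟩ = ⟨e^{tΔ}u(0), w⟩`
for all `w ∈ H¹⁰_df` (self-adjointness `pairing_heat_left`, the datum is attained in `(H¹⁰_df)*`), hence
`u t = e^{tΔ} u(0)` and `‖u t‖_{H¹⁰} ≤ ‖u(0)‖_{H¹⁰}`; the `H¹⁰` continuation criterion for the averaged
equation of ANY averaging datum (landed `stub_thesis_H10Continuation`) then extends `u` past `S`,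
contradicting the no-extension clause. [cite: Tao2016AveragedNS, §1.1 (1.15)] -/
theorem zero_not_mem_btSet_of_form_eq_zero {𝒜 : AveragingDatum} (h0 : ∀ u v w : L2C, 𝒜.form u v w = 0)
    (M : ℝ) : (0 : ℝ) ∉ btSet[𝒜, M] := by
  have hdiag : ∀ a c : L2C, ((1 - (0 : ℝ) : ℝ) : ℂ) * 𝒜.form a a c + (((0 : ℝ) : ℝ) : ℂ) * eulerForm a a c =
      𝒜.form a a c := fun a c => by
    push_cast
    ring
  simp only [mem_setOf_eq,
    isMildSolutionFor_congr_diag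
      (T := fun a b c => ((1 - (0 : ℝ) : ℝ) : ℂ) * 𝒜.form a b c + (((0 : ℝ) : ℝ) : ℂ) * eulerForm a b c)
      (T' := 𝒜.form) hdiag]
  rintro ⟨-, u₀, hdiv, S, hS, u, hu, -, hnoext⟩
  apply hnoext
  have h0S : (0 : ℝ) ∈ Ico 0 S := ⟨le_rfl, hS⟩
  have hu0 : MemH10df (u 0) := hu.1 0 h0S
  -- `u t = e^{tΔ} u(0)` on `[0,S)`
  have heq : ∀ t ∈ Ico 0 S, u t = heat t (u 0) := by
    intro t ht
    refine eq_of_forall_pairing_eq (hu.1 t ht) (hu0.heat t) fun w hw => ?_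
    have h1 := hu.2.2 t ht w hw
    simp only [h0, intervalIntegral.integral_zero, add_zero] at h1
    rw [h1, pairing_heat_left, pairing_heat_left, hu.initial h0S (hw.heat t)]
  -- hence the `H¹⁰` norm stays bounded, and the continuation criterion extends `u`
  have hbd : ∃ C : ℝ, ∀ t ∈ Ico 0 S, eFourierSobolevNorm 10 (u t) ≤ ENNReal.ofReal C := by
    refine ⟨(eFourierSobolevNorm 10 (u 0)).toReal, fun t ht => ?_⟩
    rw [ENNReal.ofReal_toReal hu0.1.ne, heq t ht]
    exact eFourierSobolevNorm_heat_le 10 t (u 0)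
  exact stub_thesis_H10Continuation 𝒜 u₀ hdiv S hS u hu hbd

/-! ### The admissible Navier–Stokes Type-I ceilings form an up-set of positive reals -/

/-- **A Navier–Stokes Type-I ceiling is positive.** If `M ≤ 0` the rate `‖u t‖_∞ ≤ M/√(S-t)` forces
`u ≡ 0` on `[0,S)`; then `⟨e^{tΔ}u₀, w⟩ = 0` for all `w ∈ H¹⁰_df` and `t ∈ [0,S)`, and by the semigroup
law also for `t ≥ S` (`e^{tΔ} = e^{(t-S/2)Δ} e^{(S/2)Δ}`, self-adjointness), so `v ≡ 0` is a mild
extension to `[0, S+1)` — contradicting the no-extension clause. [cite: Tao2016AveragedNS, §1.1 (1.15)] -/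
theorem pos_of_nsTypeI {M : ℝ} (h : nsTypeI[M]) : 0 < M := by
  by_contra hM
  push Not at hM
  obtain ⟨u₀, -, S, hS, u, hu, hrate, hnoext⟩ := h
  -- the rate forces `u ≡ 0` on `[0,S)`
  have hz : ∀ t ∈ Ico 0 S, u t = 0 := fun t ht => by
    have h1 := hrate t ht
    rw [ENNReal.ofReal_eq_zero.2 (div_nonpos_of_nonpos_of_nonneg hM (Real.sqrt_nonneg _)),
      nonpos_iff_eq_zero, eLpNorm_eq_zero_iff (Lp.aestronglyMeasurable _) ENNReal.top_ne_zero] at h1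
    exact Lp.eq_zero_iff_ae_eq_zero.2 h1
  -- hence `⟨e^{tΔ} u₀, w⟩ = 0` for `t ∈ [0,S)` …
  have hpair : ∀ t ∈ Ico 0 S, ∀ w, MemH10df w → pairing (heat t (schwartzL2 u₀)) w = 0 := by
    intro t ht w hw
    have h1 := hu.2.2 t ht w hw
    have hint : ∫ s in (0 : ℝ)..t, eulerForm (u s) (u s) (heat (t - s) w) = 0 := by
      refine (intervalIntegral.integral_congr (g := fun _ => (0 : ℂ)) fun s hs => ?_).trans
        intervalIntegral.integral_zero
      have hs' : s ∈ Ico 0 S := by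
        rw [uIcc_of_le ht.1] at hs
        exact ⟨hs.1, hs.2.trans_lt ht.2⟩
      show eulerForm (u s) (u s) (heat (t - s) w) = 0
      rw [hz s hs', eulerForm_zero_left]
    rw [hz t ht, pairing_zero_left, hint, add_zero] at h1
    exact h1.symm
  -- … and for every `t ≥ 0`, by the semigroup law
  have hpair' : ∀ t : ℝ, 0 ≤ t → ∀ w, MemH10df w → pairing (heat t (schwartzL2 u₀)) w = 0 := by
    intro t ht w hw
    by_cases htS : t < S
    · exact hpair t ⟨ht, htS⟩ w hw
    · have h2 : 0 ≤ t - S / 2 := by linarith [not_lt.1 htS]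
      have hsg := heat_heat h2 (half_pos hS).le (schwartzL2 u₀)
      rw [sub_add_cancel] at hsg
      rw [← hsg, pairing_heat_left]
      exact hpair (S / 2) ⟨(half_pos hS).le, half_lt_self hS⟩ _ (hw.heat _)
  -- the zero curve is a mild extension to `[0, S+1)`
  refine hnoext ⟨S + 1, by linarith, fun _ => 0, ⟨fun _ _ => memH10df_zero, continuousInH10On_zero _,
    fun t ht w hw => ?_⟩, fun t ht => (hz t ht).symm⟩
  rw [pairing_zero_left, hpair' t ht.1 w hw, zero_add]
  simp only [eulerForm_zero_left, intervalIntegral.integral_zero]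

/-- **Monotonicity in the ceiling**: an `M`-witness is an `M'`-witness for `M ≤ M'`. [folklore] -/
theorem nsTypeI_mono {M M' : ℝ} (h : M ≤ M') (hM : nsTypeI[M]) : nsTypeI[M'] := by
  obtain ⟨u₀, hdiv, S, hS, u, hu, hrate, hno⟩ := hM
  exact ⟨u₀, hdiv, S, hS, u, hu, fun t ht => (hrate t ht).trans
    (ENNReal.ofReal_le_ofReal (div_le_div_of_nonneg_right h (Real.sqrt_nonneg _))), hno⟩

/-! ### Closedness at a form-zero datum ⇒ attainment and a temperature floor -/

/-- **Attainment.** If the bounded-temperature blow-up sets of a form-zero datum are closed, then a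
positive ceiling `m` all of whose strict upper ceilings are admissible for Navier–Stokes is itself
admissible: at ceiling `2m` the parameters `θ ∈ (1/2, 1]` are members (`θ · 2m > m`), they accumulate at
`1/2`, which is then a member, i.e. `(1/2)·2m = m` is admissible. [cite: Tao2016AveragedNS, §1.1 (1.15)] -/
theorem nsTypeI_of_forall_lt {𝒜 : AveragingDatum} (h0 : ∀ u v w : L2C, 𝒜.form u v w = 0)
    (hcl : ∀ M : ℝ, IsClosed btSet[𝒜, M]) {m : ℝ} (hm : 0 < m)
    (h : ∀ M : ℝ, m < M → nsTypeI[M]) : nsTypeI[m] := by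
  have hsub : Ioc (1 / 2 : ℝ) 1 ⊆ btSet[𝒜, 2 * m] := fun θ hθ =>
    (mem_btSet_iff_of_form_eq_zero h0 (by linarith [hθ.1]) hθ.2 (2 * m)).2
      (h _ (by nlinarith [hθ.1]))
  have hmem : (1 / 2 : ℝ) ∈ btSet[𝒜, 2 * m] := by
    refine (hcl (2 * m)).closure_subset_iff.2 hsub ?_
    rw [closure_Ioc (by norm_num)]
    exact ⟨le_rfl, by norm_num⟩
  have h' := (mem_btSet_iff_of_form_eq_zero h0 (by norm_num) (by norm_num) (2 * m)).1 hmem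
  rwa [show (1 / 2 : ℝ) * (2 * m) = m by ring] at h'

/-- **Temperature floor.** If the bounded-temperature blow-up sets of a form-zero datum are closed,
Navier–Stokes cannot blow up at every positive ceiling: at ceiling `1` all of `(0,1]` would be members,
accumulating at the non-member `0` (`zero_not_mem_btSet_of_form_eq_zero`). [cite: Tao2016AveragedNS, §1.1 (1.15)] -/
theorem not_forall_pos_nsTypeI {𝒜 : AveragingDatum} (h0 : ∀ u v w : L2C, 𝒜.form u v w = 0)
    (hcl : ∀ M : ℝ, IsClosed btSet[𝒜, M]) : ¬ ∀ M : ℝ, 0 < M → nsTypeI[M] := by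
  intro h
  have hsub : Ioc (0 : ℝ) 1 ⊆ btSet[𝒜, 1] := fun θ hθ =>
    (mem_btSet_iff_of_form_eq_zero h0 hθ.1 hθ.2 1).2 (h _ (by rw [mul_one]; exact hθ.1))
  have hmem : (0 : ℝ) ∈ btSet[𝒜, 1] := by
    refine (hcl 1).closure_subset_iff.2 hsub ?_
    rw [closure_Ioc zero_ne_one]
    exact ⟨le_rfl, zero_le_one⟩
  exact zero_not_mem_btSet_of_form_eq_zero h0 1 hmem


/-- **The crux forces attainment of Navier–Stokes Type-I ceilings** (apply `nsTypeI_of_forall_lt` at the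
zero averaging datum, `exists_form_eq_zero`): under `BoundedTemperatureClosed`, a positive ceiling all of
whose strict upper ceilings carry Schwartz-data `H¹⁰_df`-mild Type-I blow-ups of Navier–Stokes carries one
itself — the infimal Type-I constant, if positive, is ATTAINED. An open Navier–Stokes statement, foreign
to the route's `closes`. [cite: KochNadirashviliSereginSverak2009, §1] -/
theorem nsTypeI_of_forall_lt_of_boundedTemperatureClosed (hC : BoundedTemperatureClosed) {m : ℝ}
    (hm : 0 < m) (h : ∀ M : ℝ, m < M → nsTypeI[M]) : nsTypeI[m] := by
  obtain ⟨𝒜, hs, hc, h0⟩ := exists_form_eq_zero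
  exact nsTypeI_of_forall_lt h0 (hC 𝒜 hs hc) hm h

/-- **The crux forces a temperature floor for Navier–Stokes** (apply `not_forall_pos_nsTypeI` at the zero
averaging datum): under `BoundedTemperatureClosed`, Navier–Stokes does not have Schwartz-data
`H¹⁰_df`-mild Type-I blow-ups at every positive ceiling. (True for classical solutions by Leray's 1934
lower bound on the blow-up rate; for Tao's `H¹⁰_df`-mild class with the `L^∞` ceiling it is not in the
tree.) [cite: KochNadirashviliSereginSverak2009, §1] -/
theorem not_forall_pos_nsTypeI_of_boundedTemperatureClosed (hC : BoundedTemperatureClosed) :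
    ¬ ∀ M : ℝ, 0 < M → nsTypeI[M] := by
  obtain ⟨𝒜, hs, hc, h0⟩ := exists_form_eq_zero
  exact not_forall_pos_nsTypeI h0 (hC 𝒜 hs hc)

end Summit.NavierStokesRegularity.NavierStokesRegularity.Theorems.BoundedTemperatureClosed.Negative

end
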